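import Summits.HubbardSuperconductivity.HubbardSuperconductivity.Theorems.AnisotropyChordTransferFibre3KT2aRow
import Summits.HubbardSuperconductivity.HubbardSuperconductivity.Theorems.AnisotropyChordTransferFibre3Resolvent

/-!
# Route `AnisotropyChord` / H0 rotor rung: PartN41-D §2 — `LowGRowForm` REDUCED to `RhatOneLoop` (+ the denominator bound, unconditional)

Theory-1 g22's PartN41-D §2 `LowGRowForm` (port …Fibre3KT2aRow) has two clauses: the row form of `lowG` (which is `RhatOneLoop` inserted
under the sum — ★ `RowD.lowGRowForm_of_rhatOneLoop : RhatOneLoop L Δ → LowGRowForm L Δ`) and the denominator bound `den(k) ≥ 2ε₁ − T⁺` on the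
low set, which holds unconditionally off the poles by the free gap `efree ≥ 3ε₁` (★ `RowD.den_ge_of_mem_lowSet`, any `T`, `L ≥ 4`).
Prover seat `hubbard-h0-rotor-p1` g27 (route lead); helper for stmt-HubbardSuperconductivity-23918 (`--supports`, helper class).
WHAT THIS IS NOT: nothing here proves superconductivity in the Hubbard model.  Tree imports only; no new definitions; no sorry.
-/

set_option linter.dupNamespace false
set_option autoImplicit false

noncomputable section

open scoped BigOperators

namespace Summit.HubbardSuperconductivity.HubbardSuperconductivity.Theorems.AnisotropyChord.Transfer.Fibre3

variable (L : ℕ) [NeZero L]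

namespace RowD

/-- low-set momenta are non-pole. [folklore] -/
theorem not_pole_of_mem_lowSet {k : Tor L × Tor L} (hk : k ∈ lowSet L) : IsPoleK1 L k.1 k.2 = false := by
  classical
  unfold lowSet at hk
  rw [Finset.mem_filter] at hk
  exact hk.2.1

/-- ★ the denominator bound on the low set: `2ε₁ − T ≤ den(T; k)` (free gap `efree ≥ 3ε₁` off the poles, `L ≥ 4`). [folklore] -/
theorem den_ge_of_mem_lowSet (hL : 4 ≤ L) (T : ℝ) {k : Tor L × Tor L} (hk : k ∈ lowSet L) :
    2 * eps1 L - T ≤ den L T k.1 k.2 := by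
  rw [den_eq]
  have := efree_ge L hL (not_pole_of_mem_lowSet L hk)
  linarith

/-- ★ `RhatOneLoop ⇒ LowGRowForm` (the row form is the one-loop form of `R̂′` inserted under the low-set sum). [folklore] -/
theorem lowGRowForm_of_rhatOneLoop (Δ : ℝ) (hR : RhatOneLoop L Δ) : LowGRowForm L Δ := by
  intro lam2 f hL hf
  refine ⟨?_, fun k hk => den_ge_of_mem_lowSet L (by omega) (Tplus L Δ f) hk⟩
  unfold lowGForm
  refine Finset.sum_congr rfl (fun k _ => ?_)
  rw [hR lam2 f (by omega) hf.1 hf.2.1 k.1 k.2]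

end RowD

end Summit.HubbardSuperconductivity.HubbardSuperconductivity.Theorems.AnisotropyChord.Transfer.Fibre3

end
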